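import Summits.KontsevichZagierPeriods.KontsevichZagierPeriods.Theses.CoactionDevissage
import Summits.KontsevichZagierPeriods.KontsevichZagierPeriods.Theorems.FurushoPentagonStuffleInKZ

/-!
# `Stuffle` (stmt-KontsevichZagierPeriods-3173, route CoactionDevissage) — proof

Statement: with `ρ u := [KZ.mzvRep u]` for admissible `u` (and `0` otherwise), for all admissible
indices `s`, `t` the stuffle (harmonic product) defect `ρ s · ρ t − Σ_{u ∈ s ∗ t} ρ u` (Hoffman's
`MZV.stuffle`, with multiplicity) lies in `KZ.relations`: the stuffle product of multiple zeta values
is realised by the Kontsevich–Zagier moves, not only as the real identity `multipleZeta_mul`.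

Proof: the route FurushoPentagon filed the same content for an ARBITRARY assignment `Z` pinned to the
simplex classes on admissible indices, `StuffleInKZ` (twin item stmt-3931), and the tree proves it:
`Summit.KontsevichZagierPeriods.FurushoPentagon.StuffleInKZ.StuffleInKZ_of`
(`Theorems/FurushoPentagonStuffleInKZ.lean`, line `cumulative-cube-lattice-paths`: the cumulative
monomial chart `tᵢ = x₀⋯xᵢ` turns each simplex class into an open-cube class (rule (2)); the product of
two cube classes is a cube class (Fubini product); the pointwise kernel identity
`cubeKernel s · cubeKernel t = Σ_{lattice paths} pathKernel` with all summands positive is finite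
integrand additivity (rule (1b)); each path kernel is the cube kernel of the merged index at
block-interleaved coordinates, a coordinate permutation (rule (2)); and the paths enumerate
`MZV.stuffle s t` as an ordered list — Soudères 2010 §1.3). The route's `ρ` is such an assignment
(`dif_pos`), so the item is the instance `Z := ρ`. This file closes the item by that theorem (lead c10
of line `Sketch` of crux `TateLifting`, banking calculus theorems where they close items). No new
mathematics.

References: M. Kontsevich, D. Zagier, *Periods* (2001), §1.2; I. Soudères, *Motivic double shuffle*,
Int. J. Number Theory 6 (2010), §1.3 (arXiv:0808.0248); M. E. Hoffman, *The algebra of multiple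
harmonic series*, J. Algebra 194 (1997), Thm 4.2.
-/

namespace Summit.KontsevichZagierPeriods.CoactionDevissage

open Literature.NumberTheory.Transcendental

/-- **`Stuffle`** (route CoactionDevissage, stmt-KontsevichZagierPeriods-3173): for admissible `s`, `t`,
`[mzvRep s]·[mzvRep t] − Σ_{u ∈ s ∗ t} [mzvRep u] ∈ KZ.relations` (with the route's `ρ`). Proof: `ρ`
agrees with `[mzvRep u]` on admissible `u` (`dif_pos`), so this is the instance `Z := ρ` of the
theorem `FurushoPentagon.StuffleInKZ.StuffleInKZ_of` (cube charts, Fubini product, lattice-path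
kernel identity as integrand additivity, coordinate permutations as changes of variables).
[Kontsevich–Zagier 2001, §1.2; arXiv:0808.0248, §1.3] [folklore] -/
theorem stuffle_proof :
    Summit.KontsevichZagierPeriods.KontsevichZagierPeriods.Theses.CoactionDevissage.Stuffle := by
  intro s t hs ht
  -- the route's assignment `ρ`, written out (it is pinned to `[mzvRep u]` on admissible `u` by `dif_pos`)
  have key := Summit.KontsevichZagierPeriods.FurushoPentagon.StuffleInKZ.StuffleInKZ_of
    (fun u => if h : MZV.IsAdmissible u then KZ.of (KZ.mzvRep u h
      (KZ.mzvIntegrand_isSemialgebraicFunOn_holds u) (KZ.mzvIntegrand_integrableOn_holds u h)) else 0)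
    (fun u hu => dif_pos hu) s t hs ht
  exact key

end Summit.KontsevichZagierPeriods.CoactionDevissage
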